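import Mathlib.MeasureTheory.Constructions.Cylinders
import Literature.MathematicalPhysics.KineticTheory.InfiniteChainInvariantStates
import Literature.Probability.LatticeModels.MarkovChainMeasure

/-!
# `EmbeddedDrudeMourre.MourreDissolution`, line `separable-vertex-faddeev-pair-sector` —
# Gibbs-state stub (H), brick: the transfer-operator (Markov-chain) state is reflection invariant

Item `stmt-AtomisticToContinuum-12594` (crux `MourreDissolution` of route `EmbeddedDrudeMourre`,
sub-problem `FouriersLaw`). The infrastructure stub `stub_gibbsClustering` asks, among the static
properties of the Gibbs state `μ` of the pinned anharmonic chain, for invariance under the spatial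
reflection `(ι σ)_x = σ_{-x}`: `μ.map ι = μ` (the symmetry splitting the fluctuation space into
`ι`-even / `ι`-odd sectors in `…FrameworkReflection`). For the transfer-operator state this is the
reversibility of the two-sided stationary Markov chain of a SYMMETRIC transfer kernel
(Georgii 2011, §10.3–§11.1; Cassandro–Olivieri–Pellegrinotti–Presutti 1978, §2: the kernel
`e^{-V(q'-q)/T}` is symmetric because `V` is even).

In the tree's definition-free format (`Literature.Probability.LatticeModels.MarkovWindowDensity`,
`…MarkovChainMeasure.exists_markovChainMeasure`): a probability measure `μ` on `ℤ → ℝ × ℝ`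
integrating every observable of a window `{a, …, a+n}` against the window density
`D a n σ = φ(σ_a) φ(σ_{a+n}) ∏_{j<n} (k(σ_{a+j}, σ_{a+j+1}) L⁻¹) ∏_{j≤n} w(σ_{a+j})` of a symmetric
kernel `k`. Then the densities are reflection covariant, `D a n (ι σ) = D (-a-n) n σ`
(reindex `j ↦ n-j`, resp. `j ↦ n-1-j` and use `k(z, y) = k(y, z)`), so by Mathlib's change of
variables in marginal integrals (`lmarginal_image` for the injection `x ↦ -x`) `μ ∘ ι⁻¹` and `μ`
agree on measurable cylinders, hence coincide (π-λ). Companion of the tree's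
`isShiftInvariant_of_windowDensity` (`InfiniteChainMarkovShift.lean`, translation covariance).

* `measurable_reflectConfig` (private; the tree's `measurable_reflect` lives in
  `…FrameworkReflection`), `reflectConfig_eq_dcomp` — the reflection;
* `windowDensity_reflect` — `D a n (ι σ) = D (-a-n) n σ`;
* `map_reflect_eq_of_windowDensity` — **the theorem** (registered helper stub, one line);
  `map_reflect_eq_of_windowDensity'` — the same with implicit data.
-/

noncomputable section

namespace Summit.AtomisticToContinuum.FouriersLaw.Theorems.MourreDissolution

open MeasureTheory Set Function Finset Literature.Probability.LatticeModels
open Literature.MathematicalPhysics.KineticTheory.HeatConduction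
open scoped ENNReal

/-! ## The reflection and the covariance of the window densities -/

/-- The spatial reflection `(ι σ)_x = σ_{-x}` of configurations is measurable (private copy of
`…FrameworkReflection.measurable_reflect`, to keep this brick's import cone minimal). [folklore] -/
private theorem measurable_reflectConfig : Measurable (fun (σ : ℤ → ℝ × ℝ) (x : ℤ) => σ (-x)) :=
  measurable_pi_lambda _ fun x => measurable_pi_apply (-x)

/-- `ι σ` is Mathlib's dependent pre-composition `σ ∘' Neg.neg`. [folklore] -/
theorem reflectConfig_eq_dcomp (σ : ℤ → ℝ × ℝ) : (fun x : ℤ => σ (-x)) = (σ ∘' fun x : ℤ => -x) := rfl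

/-- **Reflection covariance of the window densities of a symmetric kernel**:
`D a n (ι σ) = D (-a-n) n σ`. [cite: Georgii2011, Thm 10.25 and §11.1] -/
theorem windowDensity_reflect {k : ℝ × ℝ → ℝ × ℝ → ℝ≥0∞} {φ w : ℝ × ℝ → ℝ≥0∞} {L : ℝ≥0∞}
    {D : ℤ → ℕ → (ℤ → ℝ × ℝ) → ℝ≥0∞} (hsym : ∀ z y, k z y = k y z)
    (hD : ∀ a n σ, D a n σ = φ (σ a) * φ (σ (a + n)) *
      (∏ j ∈ Finset.range n, k (σ (a + j)) (σ (a + j + 1)) * L⁻¹) *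
      ∏ j ∈ Finset.range (n + 1), w (σ (a + j)))
    (a : ℤ) (n : ℕ) (σ : ℤ → ℝ × ℝ) :
    D a n (fun x : ℤ => σ (-x)) = D (-a - n) n σ := by
  rw [hD, hD]
  have hφ2 : φ (σ (-a)) * φ (σ (-(a + (n : ℤ)))) = φ (σ (-a - n)) * φ (σ (-a - n + n)) := by
    rw [mul_comm, show -(a + (n : ℤ)) = -a - n by ring, show -a - (n : ℤ) + n = -a by ring]
  have hw2 : ∏ j ∈ Finset.range (n + 1), w (σ (-(a + (j : ℤ)))) =
      ∏ j ∈ Finset.range (n + 1), w (σ (-a - n + (j : ℤ))) := by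
    rw [← Finset.prod_range_reflect (fun j : ℕ => w (σ (-(a + (j : ℤ))))) (n + 1)]
    refine Finset.prod_congr rfl fun j hj => ?_
    have hj' := Finset.mem_range.1 hj
    rw [show -(a + ((n + 1 - 1 - j : ℕ) : ℤ)) = -a - n + (j : ℤ) by omega]
  have hk2 : ∏ j ∈ Finset.range n, k (σ (-(a + (j : ℤ)))) (σ (-(a + (j : ℤ) + 1))) * L⁻¹ =
      ∏ j ∈ Finset.range n, k (σ (-a - n + (j : ℤ))) (σ (-a - n + (j : ℤ) + 1)) * L⁻¹ := by
    rw [← Finset.prod_range_reflect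
      (fun j : ℕ => k (σ (-(a + (j : ℤ)))) (σ (-(a + (j : ℤ) + 1))) * L⁻¹) n]
    refine Finset.prod_congr rfl fun j hj => ?_
    have hj' := Finset.mem_range.1 hj
    rw [hsym (σ (-(a + ((n - 1 - j : ℕ) : ℤ)))),
      show -(a + ((n - 1 - j : ℕ) : ℤ) + 1) = -a - n + (j : ℤ) by omega,
      show -(a + ((n - 1 - j : ℕ) : ℤ)) = -a - n + (j : ℤ) + 1 by omega]
  rw [hφ2, hw2, hk2]

/-! ## Reflection invariance -/

/-- **Measures with symmetric transfer-kernel window densities are reflection invariant**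
(registered helper stub of `stub_gibbsClustering`, F1 brick "reflection"): if a probability
measure `μ` on `ℤ → ℝ × ℝ` integrates every measurable observable of a window `{a, …, a+n}` to
`(∫⋯∫⁻_{a,…,a+n} Φ · D a n)(η)` with the window densities `D` of a SYMMETRIC kernel `k`
(`MarkovWindowDensity`), then `μ ∘ ι⁻¹ = μ` for the reflection `(ι σ)_x = σ_{-x}` — the
reversibility of the two-sided stationary chain (Georgii 2011, §10.3 and Thm 10.25 / §11.1;
COPP 1978 §2). [cite: Georgii2011, Thm 10.25 and §11.1] -/
theorem map_reflect_eq_of_windowDensity : ∀ (k : ℝ × ℝ → ℝ × ℝ → ENNReal) (φ w : ℝ × ℝ → ENNReal) (L : ENNReal) (D : ℤ → ℕ → (ℤ → ℝ × ℝ) → ENNReal), Measurable (Function.uncurry k) → Measurable φ → Measurable w → (∀ z y, k z y = k y z) → (∀ a n σ, D a n σ = φ (σ a) * φ (σ (a + n)) * (∏ j ∈ Finset.range n, k (σ (a + j)) (σ (a + j + 1)) * L⁻¹) * ∏ j ∈ Finset.range (n + 1), w (σ (a + j))) → ∀ (μ : MeasureTheory.Measure (ℤ → ℝ × ℝ)),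 MeasureTheory.IsProbabilityMeasure μ → (∀ (a : ℤ) (n : ℕ) (Φ : (ℤ → ℝ × ℝ) → ENNReal), Measurable Φ → DependsOn Φ (↑(Finset.Icc a (a + n)) : Set ℤ) → ∀ η : ℤ → ℝ × ℝ, ∫⁻ σ, Φ σ ∂μ = (∫⋯∫⁻_Finset.Icc a (a + n), (fun σ => Φ σ * D a n σ) ∂fun _ : ℤ => (MeasureTheory.volume : MeasureTheory.Measure (ℝ × ℝ))) η) → μ.map (fun (σ : ℤ → ℝ × ℝ) (x : ℤ) => σ (-x)) = μ := by
  intro k φ w L D hk hφ hw hsym hD μ hprob hμ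
  classical
  set ι : (ℤ → ℝ × ℝ) → (ℤ → ℝ × ℝ) := fun σ x => σ (-x) with hι
  have hιm : Measurable ι := measurable_reflectConfig
  haveI : IsProbabilityMeasure (μ.map ι) := Measure.isProbabilityMeasure_map hιm.aemeasurable
  -- agreement on cylinders
  have hcyl : ∀ s ∈ measurableCylinders (fun _ : ℤ => ℝ × ℝ), (μ.map ι) s = μ s := by
    intro s hs
    obtain ⟨I, C, hC, rfl⟩ := (mem_measurableCylinders _).1 hs
    have hA : MeasurableSet (cylinder I C) := MeasurableSet.cylinder (α := fun _ : ℤ => ℝ × ℝ) I hC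
    rw [Measure.map_apply hιm hA, ← lintegral_indicator_one (hιm hA), ← lintegral_indicator_one hA]
    -- a window `{a, …, a+n}` containing `I`
    set N : ℕ := I.sup Int.natAbs with hN
    set a : ℤ := -(N : ℤ) with ha
    set n : ℕ := 2 * N with hn
    have hI : I ⊆ Finset.Icc a (a + n) := by
      have := subset_Icc_sup_natAbs I
      rw [ha, hn]; exact this
    -- the indicator of `ι ⁻¹' A` is `𝟙_A ∘ ι`, an observable of the window `{-a-n, …, -a}`
    have hind : ∀ σ, (ι ⁻¹' cylinder I C).indicator (1 : (ℤ → ℝ × ℝ) → ℝ≥0∞) σ =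
        (cylinder I C).indicator (1 : (ℤ → ℝ × ℝ) → ℝ≥0∞) (ι σ) := fun σ => by
      by_cases h : ι σ ∈ cylinder I C
      · rw [indicator_of_mem h, indicator_of_mem (Set.mem_preimage.2 h)]
        rfl
      · rw [indicator_of_notMem h, indicator_of_notMem fun h' => h (Set.mem_preimage.1 h')]
    have hAdep : DependsOn ((cylinder I C).indicator (1 : (ℤ → ℝ × ℝ) → ℝ≥0∞)) (↑I : Set ℤ) :=
      fun x y hxy => dependsOn_cylinder_indicator_const C (1 : ℝ≥0∞) hxy
    have hAdep' : DependsOn ((cylinder I C).indicator (1 : (ℤ → ℝ × ℝ) → ℝ≥0∞))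
        (↑(Finset.Icc a (a + n)) : Set ℤ) :=
      hAdep.mono fun i hi => Finset.mem_coe.2 (hI (Finset.mem_coe.1 hi))
    have hdep : DependsOn (fun σ => (cylinder I C).indicator (1 : (ℤ → ℝ × ℝ) → ℝ≥0∞) (ι σ))
        (↑(Finset.Icc (-a - n) (-a - n + n)) : Set ℤ) := by
      intro x y hxy
      refine hAdep fun i hi => ?_
      have hi' : i ∈ Finset.Icc a (a + n) := hI (Finset.mem_coe.1 hi)
      simp only [Finset.mem_Icc] at hi'
      show x (-i) = y (-i)
      exact hxy (-i) (Finset.mem_coe.2 (Finset.mem_Icc.2 ⟨by omega, by omega⟩))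
    have hmeasA : Measurable ((cylinder I C).indicator (1 : (ℤ → ℝ × ℝ) → ℝ≥0∞)) :=
      measurable_one.indicator hA
    have hmeasΦ : Measurable fun σ => (cylinder I C).indicator (1 : (ℤ → ℝ × ℝ) → ℝ≥0∞) (ι σ) :=
      hmeasA.comp hιm
    have hF : Measurable fun σ : ℤ → ℝ × ℝ =>
        (cylinder I C).indicator (1 : (ℤ → ℝ × ℝ) → ℝ≥0∞) σ * D a n σ :=
      hmeasA.mul (measurable_D hk hφ hw hD a n)
    set η₀ : ℤ → ℝ × ℝ := fun _ => (0, 0) with hη₀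
    calc ∫⁻ σ, (ι ⁻¹' cylinder I C).indicator 1 σ ∂μ
        = ∫⁻ σ, (cylinder I C).indicator (1 : (ℤ → ℝ × ℝ) → ℝ≥0∞) (ι σ) ∂μ :=
          lintegral_congr fun σ => hind σ
      _ = (∫⋯∫⁻_Finset.Icc (-a - n) (-a - n + n),
            (fun σ => (cylinder I C).indicator (1 : (ℤ → ℝ × ℝ) → ℝ≥0∞) (ι σ) * D (-a - n) n σ)
            ∂fun _ : ℤ => (volume : Measure (ℝ × ℝ))) η₀ := hμ (-a - n) n _ hmeasΦ hdep η₀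
      _ = (∫⋯∫⁻_(Finset.Icc a (a + n)).image (fun x : ℤ => -x),
            ((fun σ => (cylinder I C).indicator (1 : (ℤ → ℝ × ℝ) → ℝ≥0∞) σ * D a n σ) ∘
              (· ∘' fun x : ℤ => -x))
            ∂fun _ : ℤ => (volume : Measure (ℝ × ℝ))) η₀ := by
          have himg : (Finset.Icc a (a + n)).image (fun x : ℤ => -x) =
              Finset.Icc (-a - n) (-a - n + n) := by
            ext x
            simp only [Finset.mem_image, Finset.mem_Icc]
            constructor
            · rintro ⟨y, hy, rfl⟩; omega
            · intro hx; exact ⟨-x, by omega, by ring⟩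
          rw [himg]
          congr 1
          funext σ
          simp only [Function.comp_apply, ← reflectConfig_eq_dcomp]
          rw [windowDensity_reflect hsym hD a n σ]
      _ = (∫⋯∫⁻_Finset.Icc a (a + n),
            (fun σ => (cylinder I C).indicator (1 : (ℤ → ℝ × ℝ) → ℝ≥0∞) σ * D a n σ)
            ∂fun _ : ℤ => (volume : Measure (ℝ × ℝ))) (η₀ ∘' fun x : ℤ => -x) :=
          lmarginal_image (μ := fun _ : ℤ => (volume : Measure (ℝ × ℝ)))
            (e := fun x : ℤ => -x) (fun x y h => neg_injective h) (Finset.Icc a (a + n))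
            (f := fun σ : ℤ → ℝ × ℝ =>
              (cylinder I C).indicator (1 : (ℤ → ℝ × ℝ) → ℝ≥0∞) σ * D a n σ) hF η₀
      _ = ∫⁻ σ, (cylinder I C).indicator 1 σ ∂μ := (hμ a n _ hmeasA hAdep' _).symm
  have huniv : (μ.map ι) univ = μ univ := by
    rw [measure_univ, measure_univ]
  exact ext_of_generate_finite (measurableCylinders fun _ : ℤ => ℝ × ℝ)
    generateFrom_measurableCylinders.symm isPiSystem_measurableCylinders hcyl huniv

/-- **Reflection invariance of the Markov-chain state** (implicit-argument form of
`map_reflect_eq_of_windowDensity`, hypotheses as in `exists_markovChainMeasure` /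
`isShiftInvariant_of_windowDensity`). [cite: Georgii2011, Thm 10.25 and §11.1] -/
theorem map_reflect_eq_of_windowDensity' {k : ℝ × ℝ → ℝ × ℝ → ℝ≥0∞} {φ w : ℝ × ℝ → ℝ≥0∞}
    {L : ℝ≥0∞} {D : ℤ → ℕ → ChainConfig → ℝ≥0∞}
    (hk : Measurable (uncurry k)) (hφ : Measurable φ) (hw : Measurable w)
    (hsym : ∀ z y, k z y = k y z)
    (hD : ∀ a n σ, D a n σ = φ (σ a) * φ (σ (a + n)) *
      (∏ j ∈ Finset.range n, k (σ (a + j)) (σ (a + j + 1)) * L⁻¹) *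
      ∏ j ∈ Finset.range (n + 1), w (σ (a + j)))
    {μ : Measure ChainConfig} [hμp : IsProbabilityMeasure μ]
    (hμ : ∀ (a : ℤ) (n : ℕ) (Φ : ChainConfig → ℝ≥0∞), Measurable Φ →
      DependsOn Φ (↑(Finset.Icc a (a + n)) : Set ℤ) → ∀ η : ChainConfig,
        ∫⁻ σ, Φ σ ∂μ = (∫⋯∫⁻_Finset.Icc a (a + n), (fun σ => Φ σ * D a n σ)
          ∂fun _ : ℤ => (volume : Measure (ℝ × ℝ))) η) :
    μ.map (fun (σ : ChainConfig) (x : ℤ) => σ (-x)) = μ :=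
  map_reflect_eq_of_windowDensity k φ w L D hk hφ hw hsym hD μ hμp hμ

end Summit.AtomisticToContinuum.FouriersLaw.Theorems.MourreDissolution

end
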